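import Literature.AnabelianGeometry.EtaleTheta.SettingModelSlice2Parallel
import HarnessLib

/-!
# (L3′) slice 2, file 11/13 — the ORIGINAL hypotheses `Original` and the line map `Λ`; `C_{F̂₂}(Û_l) = 1`; the slim hypotheses `OriginalSlim ⇒ Original`; `Inn(f)` as `≃ₜ*`

Part of the (L3′) slice-2 chain (abc-iut-L6-t19; FILING SHAPE derived from scratch v5 `Slice2TheoremR2ScratchV5.lean`
551b982286441a66 by the edits E1–E4/D1–D3/H1–H2 of FILING-PLAN-SLICE2.md 9643c7e42a42ad24 and the OPTION-L re-cut of §F v1.19gz (W):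
one definitions file + twelve theorem files).  Classical profinite group theory about OUR semi-synthetic `F₂hatT`; the objects and laws
are those of the one-sentence residual of record (cf. [EtTh] §1, §2 for the role they play there — nothing of [EtTh]/[IUTchII]/[IUTchIII]
in print is asserted; no side on [IUTchIII] Cor. 3.12; MORATORIUM (E): no application to `hext_at_iff_exists_f2hatAut_of_eq`).
-/

noncomputable section

open scoped Pointwise

namespace Literature.AnabelianGeometry.EtaleTheta.SettingModel.Slice2

open Literature.AnabelianGeometry.EtaleTheta.SettingModel
open Literature.AnabelianGeometry.EtaleTheta (ZHatLevel.level ZHatLevel.levelChar)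
open Literature.AnabelianGeometry.SemiGraphs (GQp)
open Literature.AnabelianGeometry.AbsoluteAnabelian
open Literature.AnabelianGeometry.AbsoluteAnabelian.AbsTopII
open _root_.Topology

/-! ## §18 COROLLARY (L3′): from the ORIGINAL laws (torus law with a cocycle, unipotent law with a
cocycle, `C`-preservation) for an automorphism `Ψ` of `Û_l`, via Prop R1b in line form (slice 1's landed
`Slice1.exists_torusNormalForm_holds`) and Theorem R2: `Ψ = Inn(f) ∘ ψ_ε` on `Û_l` with `f ∈ N_F(Û_l)`, `ψ_ε ∈ {id, σ̂}`
— so `Ψ` extends to `F̂₂`. -/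

section Corollary

variable {p : ℕ} [Fact p.Prime] {l : ℕ+} {U₀ : Subgroup (GQp p)} {m : ℕ+} {Ψ : F₂hatT → F₂hatT}

namespace Original

/-- The standard cusp of the line `gB`: `c_g := g b^l g⁻¹ ∈ Ker ĥ_l ⊂ Û_l`. [cite: MochizukiEtTh2009, §1 p.12] -/
theorem cusp_mem_Uhat (g : F₂hatT) : g * bPow (ZHatLevel.eta (l : ℤ)) * g⁻¹ ∈ Uhat l := by
  have hb : hHat l (bPow (ZHatLevel.eta (l : ℤ))) = 1 := by
    rw [hHat_bPow, level_eta_self]; rfl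
  rw [mem_Uhat_iff, map_mul, map_mul, map_inv, hb, mul_one, mul_inv_cancel]
  exact ⟨rfl, rfl⟩

/-- `Ψ 1 = 1`. [cite: MochizukiEtTh2009, §1 p.12] -/
theorem psi_one (h : Original p l U₀ m Ψ) : Ψ 1 = 1 := by
  have := h.mul 1 (one_mem _) 1 (one_mem _)
  rw [one_mul] at this
  exact left_eq_mul.mp this

/-- Images of commuting elements commute, and conversely. [cite: MochizukiEtTh2009, §1 p.12] -/
theorem commute_iff (h : Original p l U₀ m Ψ) {x y : F₂hatT} (hx : x ∈ Uhat l) (hy : y ∈ Uhat l) :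
    Ψ x * Ψ y = Ψ y * Ψ x ↔ x * y = y * x := by
  constructor
  · intro hc
    have e : Ψ (x * y) = Ψ (y * x) := by rw [h.mul x hx y hy, h.mul y hy x hx, hc]
    exact h.inj _ (mul_mem hx hy) _ (mul_mem hy hx) e
  · intro hc
    rw [← h.mul x hx y hy, hc, h.mul y hy x hx]

/-- The image of the standard cusp of `gB` is a NON-TRIVIAL `b`-type element. [cite: MochizukiEtTh2009, §1 p.12] -/
theorem exists_image_cusp (h : Original p l U₀ m Ψ) (g : F₂hatT) :
    ∃ hg : F₂hatT, ∃ μ : ZH, Ψ (g * bPow (ZHatLevel.eta (l : ℤ)) * g⁻¹) = hg * bPow μ * hg⁻¹ ∧ bPow μ ≠ 1 := by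
  obtain ⟨hg, μ, e⟩ := (h.btype _ (cusp_mem_Uhat g)).1 ((isBType_bPow _).conj g)
  refine ⟨hg, μ, e, fun h0 => ?_⟩
  rw [h0, mul_one, mul_inv_cancel] at e
  have := h.inj _ (cusp_mem_Uhat g) 1 (one_mem _) (by rw [e, h.psi_one])
  rw [mul_inv_eq_one, mul_eq_left] at this
  exact bPow_eta_l_ne_one l this

/-- **The line map `Λ`**: `Λ g` is a conjugator with `Ψ(c_g) = Λg · b^μ · (Λg)⁻¹`. [cite: MochizukiEtTh2009, §1 p.12] -/
def lineMap (h : Original p l U₀ m Ψ) (g : F₂hatT) : F₂hatT := Classical.choose (h.exists_image_cusp g)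

/-- [cite: MochizukiEtTh2009, §1 p.12] -/
theorem lineMap_spec (h : Original p l U₀ m Ψ) (g : F₂hatT) :
    ∃ μ : ZH, Ψ (g * bPow (ZHatLevel.eta (l : ℤ)) * g⁻¹) = h.lineMap g * bPow μ * (h.lineMap g)⁻¹ ∧ bPow μ ≠ 1 :=
  Classical.choose_spec (h.exists_image_cusp g)

/-- Elements of one line commute. [cite: MochizukiEtTh2009, §1 p.12] -/
theorem conj_bPow_commute_of_inv_mul_mem {g g' : F₂hatT} (hgg : g⁻¹ * g' ∈ bAxis) (u v : ZH) :
    (g * bPow u * g⁻¹) * (g' * bPow v * g'⁻¹) = (g' * bPow v * g'⁻¹) * (g * bPow u * g⁻¹) := by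
  obtain ⟨w, hw⟩ := (mem_bAxis_iff _).1 hgg
  have hg' : g' = g * bPow w := by rw [hw]; group
  rw [hg']
  have key : bPow u * (bPow w * bPow v * (bPow w)⁻¹) = (bPow w * bPow v * (bPow w)⁻¹) * bPow u := by
    rw [bPow_comm w v, mul_inv_cancel_right, bPow_comm u v]
  calc g * bPow u * g⁻¹ * (g * bPow w * bPow v * (g * bPow w)⁻¹)
      = g * (bPow u * (bPow w * bPow v * (bPow w)⁻¹)) * g⁻¹ := by group
    _ = g * ((bPow w * bPow v * (bPow w)⁻¹) * bPow u) * g⁻¹ := by rw [key]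
    _ = g * bPow w * bPow v * (g * bPow w)⁻¹ * (g * bPow u * g⁻¹) := by group

/-- `Λ` respects lines. [cite: MochizukiEtTh2009, §1 p.12] -/
theorem lineMap_B (h : Original p l U₀ m Ψ) (x y : F₂hatT) (hxy : x⁻¹ * y ∈ bAxis) :
    (h.lineMap x)⁻¹ * h.lineMap y ∈ bAxis := by
  obtain ⟨μ, hμ, hμ0⟩ := h.lineMap_spec x
  obtain ⟨ν, hν, hν0⟩ := h.lineMap_spec y
  apply inv_mul_mem_bAxis_of_commute hμ0 hν0
  rw [← hμ, ← hν, h.commute_iff (cusp_mem_Uhat x) (cusp_mem_Uhat y)]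
  exact conj_bPow_commute_of_inv_mul_mem hxy _ _

/-- `Λ` is injective on lines. [cite: MochizukiEtTh2009, §1 p.12] -/
theorem lineMap_inj (h : Original p l U₀ m Ψ) (x y : F₂hatT) (hxy : (h.lineMap x)⁻¹ * h.lineMap y ∈ bAxis) :
    x⁻¹ * y ∈ bAxis := by
  obtain ⟨μ, hμ, hμ0⟩ := h.lineMap_spec x
  obtain ⟨ν, hν, hν0⟩ := h.lineMap_spec y
  apply inv_mul_mem_bAxis_of_commute (bPow_eta_l_ne_one l) (bPow_eta_l_ne_one l)
  rw [← h.commute_iff (cusp_mem_Uhat x) (cusp_mem_Uhat y), hμ, hν]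
  exact conj_bPow_commute_of_inv_mul_mem hxy _ _

/-- `Λ` is surjective on lines (`Ψ(Û) = Û` and (C)). [cite: MochizukiEtTh2009, §1 p.12] -/
theorem lineMap_surj (h : Original p l U₀ m Ψ) (y : F₂hatT) : ∃ x : F₂hatT, (h.lineMap x)⁻¹ * y ∈ bAxis := by
  obtain ⟨w, hwU, hw⟩ := h.surj _ (cusp_mem_Uhat y)
  obtain ⟨g, ν, rfl⟩ := (h.btype w hwU).2 (by rw [hw]; exact (isBType_bPow _).conj y)
  have hν0 : bPow ν ≠ 1 := by
    intro h0
    rw [h0, mul_one, mul_inv_cancel, h.psi_one] at hw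
    have := hw.symm
    rw [mul_inv_eq_one, mul_eq_left] at this
    exact bPow_eta_l_ne_one l this
  refine ⟨g, ?_⟩
  obtain ⟨μ, hμ, hμ0⟩ := h.lineMap_spec g
  apply inv_mul_mem_bAxis_of_commute hμ0 (bPow_eta_l_ne_one l)
  rw [← hμ, ← hw, h.commute_iff (cusp_mem_Uhat g) hwU]
  exact conj_bPow_commute_of_inv_mul_mem (by rw [inv_mul_cancel]; exact one_mem _) _ _

/-- `Λ` intertwines the torus with its `η`-twist. [cite: MochizukiEtTh2009, §1 p.12] -/
theorem lineMap_twist (h : Original p l U₀ m Ψ) {η : GQp p → F₂hatT}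
    (hη : ∀ σ ∈ U₀, ∀ x ∈ Uhat l, Ψ (twist (chi p σ) x) = η σ * twist (chi p σ) (Ψ x) * (η σ)⁻¹)
    (v : GQp p) (hv : v ∈ U₀) (x : F₂hatT) :
    (h.lineMap (twist (chi p v) x))⁻¹ * (η v * twist (chi p v) (h.lineMap x)) ∈ bAxis := by
  obtain ⟨μ, hμ, hμ0⟩ := h.lineMap_spec (twist (chi p v) x)
  obtain ⟨ν, hν, hν0⟩ := h.lineMap_spec x
  have hν' : bPow (chi p v ν) ≠ 1 := by
    rw [Ne, bPow_eq_one_iff]; intro h0; apply hν0; rw [bPow_eq_one_iff]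
    simpa using congrArg (chi p v)⁻¹ h0
  apply inv_mul_mem_bAxis_of_commute hμ0 hν'
  -- `Ψ(θ c_x) = η θ(Λx) b^{χν} θ(Λx)⁻¹ η⁻¹`
  have e1 : Ψ (twist (chi p v) (x * bPow (ZHatLevel.eta (l : ℤ)) * x⁻¹)) =
      η v * twist (chi p v) (h.lineMap x) * bPow (chi p v ν) * (η v * twist (chi p v) (h.lineMap x))⁻¹ := by
    rw [hη v hv _ (cusp_mem_Uhat x), hν, map_mul, map_mul, map_inv, twist_bPow]; group
  rw [← hμ, ← e1, h.commute_iff (cusp_mem_Uhat _) (twist_mem_Uhat _ (cusp_mem_Uhat x)), map_mul, map_mul, map_inv,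
    twist_bPow]
  exact conj_bPow_commute_of_inv_mul_mem (by rw [inv_mul_cancel]; exact one_mem _) _ _

/-- **PROP R1b applied: the normalised map `Ψ′ := Inn(f)⁻¹ ∘ Ψ` satisfies the RESIDUAL hypotheses.**
[cite: MochizukiEtTh2009, §1 p.12] -/
theorem residual_of_normalForm (h : Original p l U₀ m Ψ) {η : GQp p → F₂hatT}
    (hη : ∀ σ ∈ U₀, ∀ x ∈ Uhat l, Ψ (twist (chi p σ) x) = η σ * twist (chi p σ) (Ψ x) * (η σ)⁻¹)
    {f : F₂hatT} (hf1 : ∀ v ∈ U₀, f⁻¹ * (η v * twist (chi p v) f) = 1) (hf2 : f⁻¹ * h.lineMap 1 ∈ bAxis) :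
    Residual p l U₀ m f (fun x => f⁻¹ * Ψ x * f) where
  dvd := h.dvd
  mul x hx y hy := by simp only [h.mul x hx y hy]; group
  cont := (continuous_const.mul h.cont).mul continuous_const
  inj x hx y hy hxy := h.inj x hx y hy (by simpa using hxy)
  mapsTo x hx := by
    rw [show f * (f⁻¹ * Ψ x * f) * f⁻¹ = Ψ x by group]; exact h.mapsTo x hx
  torus σ hσ x hx := by
    have hηf : η σ = f * (twist (chi p σ) f)⁻¹ := by
      have e := hf1 σ hσ
      rw [inv_mul_eq_one] at e
      rw [eq_mul_inv_iff_mul_eq]; exact e.symm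
    simp only [hη σ hσ x hx, hηf, map_mul, map_inv]
    group
  btype x hx := by
    rw [h.btype x hx]
    constructor
    · intro hb; simpa using hb.conj f⁻¹
    · intro hb
      have := hb.conj f
      rwa [show f * (f⁻¹ * Ψ x * f) * f⁻¹ = Ψ x by group] at this
  axis x hx := by
    obtain ⟨μ₁, hμ₁, hμ₁0⟩ := h.lineMap_spec 1
    rw [one_mul, inv_one, mul_one] at hμ₁
    constructor
    · intro hxB
      obtain ⟨u, rfl⟩ := (mem_bAxis_iff _).1 hxB
      by_cases h0 : bPow u = 1
      · rw [h0, h.psi_one, mul_one, inv_mul_cancel]; exact one_mem _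
      -- `Ψ(b^u)` is `b`-type, commutes with `Ψ(b^l) = Λ1 b^{μ₁} Λ1⁻¹`, hence lies on the line `Λ1 B = f B`
      obtain ⟨g, ν, hg⟩ := (h.btype _ hx).1 (isBType_bPow u)
      have hν0 : bPow ν ≠ 1 := by
        intro hn; rw [hn, mul_one, mul_inv_cancel] at hg
        exact h0 ((h.inj _ hx 1 (one_mem _) (by rw [hg, h.psi_one])))
      have hc : Ψ (bPow u) * Ψ (bPow (ZHatLevel.eta (l : ℤ))) = Ψ (bPow (ZHatLevel.eta (l : ℤ))) * Ψ (bPow u) := by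
        rw [h.commute_iff hx (bPow_mem_Uhat _)]; exact bPow_comm _ _
      rw [hg, hμ₁] at hc
      have h1 := inv_mul_mem_bAxis_of_commute hν0 hμ₁0 hc
      -- `g ∈ Λ1 B = f B`
      have hfg : f⁻¹ * g ∈ bAxis := by
        have := mul_mem hf2 (inv_mem h1)
        rwa [mul_inv_rev, inv_inv, mul_assoc, mul_inv_cancel_left] at this
      obtain ⟨w, hw⟩ := (mem_bAxis_iff _).1 hfg
      rw [hg, show g = f * bPow w by rw [hw]; group]
      rw [show f⁻¹ * (f * bPow w * bPow ν * (f * bPow w)⁻¹) * f = bPow w * bPow ν * (bPow w)⁻¹ by group]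
      exact mul_mem (mul_mem (bPow_mem_bAxis w) (bPow_mem_bAxis ν)) (inv_mem (bPow_mem_bAxis w))
    · intro hB
      -- `Ψ x ∈ f B f⁻¹`
      by_cases hx1 : Ψ x = 1
      · have := h.inj x hx 1 (one_mem _) (by rw [hx1, h.psi_one]); rw [this]; exact one_mem _
      obtain ⟨w, hw⟩ := (mem_bAxis_iff _).1 hB
      have hΨx : Ψ x = f * bPow w * f⁻¹ := by rw [hw]; group
      have hw0 : bPow w ≠ 1 := by intro h0; apply hx1; rw [hΨx, h0, mul_one, mul_inv_cancel]
      obtain ⟨g, u, rfl⟩ := (h.btype x hx).2 ⟨f, w, hΨx⟩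
      have hu0 : bPow u ≠ 1 := by intro h0; apply hx1; rw [h0, mul_one, mul_inv_cancel, h.psi_one]
      -- `c_g` commutes with `x`, so `Ψ(c_g) = Λg b^μ Λg⁻¹` commutes with `f b^w f⁻¹`: `Λg ∈ f B`
      obtain ⟨μ, hμ, hμ0⟩ := h.lineMap_spec g
      have hc : Ψ (g * bPow (ZHatLevel.eta (l : ℤ)) * g⁻¹) * Ψ (g * bPow u * g⁻¹) =
          Ψ (g * bPow u * g⁻¹) * Ψ (g * bPow (ZHatLevel.eta (l : ℤ)) * g⁻¹) := by
        rw [h.commute_iff (cusp_mem_Uhat g) hx]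
        exact conj_bPow_commute_of_inv_mul_mem (by rw [inv_mul_cancel]; exact one_mem _) _ _
      rw [hμ, hΨx] at hc
      have h1 : (h.lineMap g)⁻¹ * f ∈ bAxis := inv_mul_mem_bAxis_of_commute hμ0 hw0 hc
      have h2 : (h.lineMap g)⁻¹ * h.lineMap 1 ∈ bAxis := by
        have := mul_mem h1 hf2; rwa [mul_assoc, mul_inv_cancel_left] at this
      have h3 := h.lineMap_inj g 1 h2
      rw [mul_one] at h3
      have hgB : g ∈ bAxis := by simpa using inv_mem h3
      obtain ⟨w', rfl⟩ := (mem_bAxis_iff _).1 hgB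
      rw [bPow_comm, mul_inv_cancel_right]; exact bPow_mem_bAxis u
  dlaw k := by
    obtain ⟨e, he⟩ := h.dlaw k
    refine ⟨f⁻¹ * e * Dp (k ^ (m : ℕ)) f, fun x hx => ?_⟩
    simp only [he x hx, map_mul, map_inv]
    group

end Original

end Corollary

/-! ## §21 SLIMNESS (audit precision P2, f-193 g27 / lead §F v1.19gz (Q)): the centralizer of `Û_l` in `F̂₂` is
trivial, so the `θ`-cocycle identity of `η` in `Original.torus` is DERIVABLE from the torus law itself
(`OriginalSlim` = `Original` without the cocycle conjunct; `OriginalSlim.toOriginal`). -/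

section Slimness

variable {p : ℕ} [Fact p.Prime] {l : ℕ+} {U₀ : Subgroup (GQp p)} {m : ℕ+} {Ψ : F₂hatT → F₂hatT}

/-- **`C_{F̂₂}(Û_l) = 1`**: an element commuting with `Û_l` commutes with `b` (so lies on `B`) and with `A = a^l`
(so is trivial, by malnormality of the cusp lines). [cite: MochizukiEtTh2009, Prop 1.5 (iii) p.23] -/
theorem eq_one_of_forall_commute_Uhat {g : F₂hatT} (hg : ∀ x ∈ Uhat l, g * x = x * g) : g = 1 := by
  have hb1 : bPow zOne ≠ 1 := bPow_eta_ne_one one_ne_zero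
  have hgB : g ∈ bAxis := mem_bAxis_of_commute_bPow hb1 (hg _ (bPow_mem_Uhat zOne))
  obtain ⟨w, rfl⟩ := (mem_bAxis_iff _).1 hgB
  by_contra hw
  have hA := hg _ ((aPow_mem_Uhat_iff _).2 (level_eta_self l))
  -- `β_l^w = b^w`
  have e : betaPow (ZHatLevel.eta (l : ℤ)) w = betaPow 1 w := by
    rw [betaPow, betaPow, aPow_one, ← hA]; group
  have hc : betaPow (ZHatLevel.eta (l : ℤ)) w * betaPow 1 w = betaPow 1 w * betaPow (ZHatLevel.eta (l : ℤ)) w := by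
    rw [e]
  have hl1 : ZHatLevel.eta (l : ℤ) = 1 := eq_of_betaPow_commute hw hw hc
  exact bPow_eta_l_ne_one l (by rw [hl1, map_one])

/-- **The cocycle identity is automatic**: `η_{uv} = η_u θ_u(η_v)` for `u, v ∈ U₀`, since
`η_{uv}⁻¹ η_u θ_u(η_v)` centralises `θ_{uv}(Ψ(Û_l)) = Û_l`. [cite: MochizukiEtTh2009, §1 p.12] -/
theorem OriginalSlim.toOriginal (h : OriginalSlim p l U₀ m Ψ) : Original p l U₀ m Ψ := by
  obtain ⟨η, hη⟩ := h.torus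
  refine
    { dvd := h.dvd
      mul := h.mul
      cont := h.cont
      inj := h.inj
      mapsTo := h.mapsTo
      surj := h.surj
      torus := ⟨η, fun u hu v hv => ?_, hη⟩
      btype := h.btype
      dlaw := h.dlaw }
  set G := η u * twist (chi p u) (η v) with hG
  -- `g := η_{uv}⁻¹ G` commutes with `Û_l`
  have hcomm : ∀ z ∈ Uhat l, ((η (u * v))⁻¹ * G) * z = z * ((η (u * v))⁻¹ * G) := by
    intro z hz
    -- write `z = θ_{uv}(Ψ x)` with `x ∈ Û_l`
    have hwU : twist (chi p (u * v))⁻¹ z ∈ Uhat l := (twist_mem_Uhat_iff _ _).2 hz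
    obtain ⟨x, hx, hΨx⟩ := h.surj _ hwU
    have hz' : z = twist (chi p (u * v)) (Ψ x) := by
      rw [hΨx, ← twist_mul, mul_inv_cancel, twist_one]
    have T1 := hη (u * v) (U₀.mul_mem hu hv) x hx
    have T2 : Ψ (twist (chi p (u * v)) x) = G * twist (chi p (u * v)) (Ψ x) * G⁻¹ := by
      rw [map_mul, twist_mul, hη u hu _ ((twist_mem_Uhat_iff _ _).2 hx), hη v hv x hx, map_mul, map_mul, map_inv,
        ← twist_mul, hG]
      group
    rw [T1] at T2
    rw [hz']
    calc (η (u * v))⁻¹ * G * twist (chi p (u * v)) (Ψ x)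
        = (η (u * v))⁻¹ * (G * twist (chi p (u * v)) (Ψ x) * G⁻¹) * G := by group
      _ = (η (u * v))⁻¹ * (η (u * v) * twist (chi p (u * v)) (Ψ x) * (η (u * v))⁻¹) * G := by rw [← T2]
      _ = twist (chi p (u * v)) (Ψ x) * ((η (u * v))⁻¹ * G) := by group
  have h1 := eq_one_of_forall_commute_Uhat hcomm
  rw [inv_mul_eq_one] at h1
  rw [h1, hG]

end Slimness

/-! ## §22 THE EXTENSION CLAUSE OF (L3′) AS A DECLARATION (audit U4 (c), f-193 g27 `probe_extends`; lead (S) (v3-a)) -/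

section Extension

variable {p : ℕ} [Fact p.Prime] {l : ℕ+} {U₀ : Subgroup (GQp p)} {m : ℕ+} {Ψ : F₂hatT → F₂hatT}

/-- [cite: MochizukiEtTh2009, §1 p.12] -/
theorem innEquiv_apply (f y : F₂hatT) : innEquiv f y = f * y * f⁻¹ := rfl

end Extension

end Literature.AnabelianGeometry.EtaleTheta.SettingModel.Slice2

end
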